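import Mathlib.Analysis.SpecialFunctions.Log.Base
import Literature.InformationTheory.Entropy.MapEntropy
import Literature.InformationTheory.Entropy.LinearMapEntropy
import HarnessLib

/-!
# A chain rule for the entropy of images of uniform distributions: revealed first coordinate

For a uniform pair `(a, b) ∈ S × T` and a family of maps `f a : T → β`, the output `(a, f a b)` —
the index `a` is revealed, then `b` is pushed through the `a`-th map — has Shannon entropy

  `H((a, f_a(b))) = log₂ |S| + (1/|S|) ∑_{a ∈ S} H(f_a(U_T))`   (`mapEntropy_prod_reveal`),

the chain rule `H(A, Y) = H(A) + H(Y | A)` for this shape (the fibre through `(a, b)` is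
`{a} × f_a⁻¹(f_a b)`); and its linear instance over `F₂`
(`mapEntropy_prod_reveal_linearMap_zmod_two`): if every `f_a` is LINEAR, the entropy is
`log₂ |S| +` the AVERAGE RANK of the `f_a`.  Typical use (route PneNP/SzkEntropy, crux
`PeaTwoMemBPP`): conditionally on one layer of variables a quadratic map over `F₂` is linear in the
other layer ("erasure genie": `H(v, M(u ⊙ v)) = n + E_v rank (M · diag v)`).

## References

* T. Cover, J. Thomas, *Elements of Information Theory*, 2nd ed., Thm 2.2.1 (chain rule) and
  (2.10) (conditional entropy as an average).  Standard; proved here for `mapEntropy`.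
-/

namespace Literature.InformationTheory.Entropy

open Finset

variable {ι ι' β : Type*} [DecidableEq ι] [DecidableEq β]

/-- The fibre of `(a, b) ↦ (a, f a b)` through `(a, b)` is `{a} × (fibre of f a through b)`.
[folklore] -/
theorem card_fiber_prod_reveal (S : Finset ι) (T : Finset ι') (f : ι → ι' → β) {a : ι} {b : ι'}
    (ha : a ∈ S) :
    (fiber (S ×ˢ T) (fun p : ι × ι' => (p.1, f p.1 p.2)) (a, f a b)).card =
      (fiber T (f a) (f a b)).card := by
  have hfib : fiber (S ×ˢ T) (fun p : ι × ι' => (p.1, f p.1 p.2)) (a, f a b) =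
      ({a} : Finset ι) ×ˢ fiber T (f a) (f a b) := by
    ext ⟨a', b'⟩
    simp only [mem_fiber, mem_product, Prod.mk.injEq, mem_singleton]
    constructor
    · rintro ⟨⟨-, hb'⟩, rfl, hfb⟩
      exact ⟨rfl, hb', hfb⟩
    · rintro ⟨rfl, hb', hfb⟩
      exact ⟨⟨ha, hb'⟩, rfl, hfb⟩
  rw [hfib, card_product, card_singleton, one_mul]

/-- **Chain rule with a revealed coordinate.** For nonempty `S, T` and maps `f a : T → β`,
`H((a, f_a(b))_{(a,b) ∼ U_{S×T}}) = log₂ |S| + (1/|S|) ∑_{a ∈ S} H(f_a(U_T))`: the entropy of the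
index plus the average entropy of the indexed images. [Cover–Thomas, Thm 2.2.1 and (2.10)]
[folklore] -/
theorem mapEntropy_prod_reveal {S : Finset ι} {T : Finset ι'} (hS : S.Nonempty) (hT : T.Nonempty)
    (f : ι → ι' → β) :
    mapEntropy (S ×ˢ T) (fun p : ι × ι' => (p.1, f p.1 p.2)) =
      Real.logb 2 S.card + (∑ a ∈ S, mapEntropy T (f a)) / S.card := by
  have hS0 : (S.card : ℝ) ≠ 0 := by exact_mod_cast hS.card_pos.ne'
  have hT0 : (T.card : ℝ) ≠ 0 := by exact_mod_cast hT.card_pos.ne'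
  have hterm : ∀ a ∈ S, ∀ b ∈ T,
      Real.logb 2 (((S ×ˢ T).card : ℝ) /
          (fiber (S ×ˢ T) (fun p : ι × ι' => (p.1, f p.1 p.2)) (a, f a b)).card) =
        Real.logb 2 S.card + Real.logb 2 ((T.card : ℝ) / (fiber T (f a) (f a b)).card) := by
    intro a ha b hb
    have hF : ((fiber T (f a) (f a b)).card : ℝ) ≠ 0 := by
      exact_mod_cast (card_fiber_pos (f a) hb).ne'
    rw [card_fiber_prod_reveal S T f ha, card_product, Nat.cast_mul, mul_div_assoc,
      Real.logb_mul hS0 (div_ne_zero hT0 hF)]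
  unfold mapEntropy
  rw [sum_product, sum_congr rfl fun a ha => sum_congr rfl fun b hb => hterm a ha b hb]
  simp only [sum_add_distrib, sum_const, nsmul_eq_mul, card_product, Nat.cast_mul]
  rw [← Finset.sum_div]
  field_simp

/-- **Revealed layer, linear maps over `F₂`: entropy is `log₂ |A|` plus the average rank.**  For a
family of linear maps `L a : V → W` over `F₂` indexed by a finite nonempty `A`,
`H((a, L_a v))_{(a,v) uniform}) = log₂ |A| + (1/|A|) ∑_a rank (L a)`.
[Cover–Thomas, Thm 2.2.1; DvirGutfreundRothblumVadhan2010, §1 p. 1] [folklore] -/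
theorem mapEntropy_prod_reveal_linearMap_zmod_two {A : Type*} [Fintype A] [DecidableEq A]
    [Nonempty A] {V W : Type*} [AddCommGroup V] [Module (ZMod 2) V] [Fintype V] [AddCommGroup W]
    [Module (ZMod 2) W] [DecidableEq W] (L : A → V →ₗ[ZMod 2] W) :
    mapEntropy ((univ : Finset A) ×ˢ (univ : Finset V)) (fun p : A × V => (p.1, L p.1 p.2)) =
      Real.logb 2 (Fintype.card A) +
        (∑ a, (Module.finrank (ZMod 2) (LinearMap.range (L a)) : ℝ)) / Fintype.card A := by
  rw [mapEntropy_prod_reveal univ_nonempty univ_nonempty (fun a v => L a v), card_univ]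
  congr 1
  congr 1
  exact sum_congr rfl fun a _ => mapEntropy_univ_linearMap_zmod_two (L a)

end Literature.InformationTheory.Entropy
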